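import Literature.AlgebraicGeometry.HodgeTheory.WeilClassesFieldHodgeOfNoTypeIVFactor
import Literature.AlgebraicGeometry.HodgeTheory.WeilClassesFieldDecomposableIffLefschetzGroup
import HarnessLib

/-!
# `r = dim_F(V_X)` is even when `W_F` is Hodge — so, with no factor of type IV, `[F:ℚ] ∣ dim X` for every subfield
# `F ⊆ End⁰(X)` and the trichotomy is a dichotomy (Moonen–Zarhin 1998, §1: Criterion (2) and the second Remark)

Layer `Literature/AlgebraicGeometry/HodgeTheory`, theorem-only sequel of the seat's `WeilClassesFieldHodgeOfNoTypeIVFactor`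
(«no factor of type IV ⟹ `n_σ = n_σ′` for every subfield `F`») and `WeilClassesFieldDecomposableIffLefschetzGroup` («`W_F`
decomposable ⟺ `G_div(X)(ℂ) ⊂ Sl_F`», unconditionally); no definition, no named fact, no `sorry`.

PRINTED STATEMENTS.  B. J. J. Moonen – Yu. G. Zarhin, *Weil classes on abelian varieties*, J. reine angew. Math. 496 (1998)
83–92 = arXiv:alg-geom/9612017 (held text `paper:arxiv-alg-geom_9612017`).  §1 (chunk p0001): «Write `V_X = H¹(X, ℚ)` and
let `r = 2g/[F:ℚ]` … The dimension `n_σ` of `V_{ℂ,σ}^{1,0}` is called the multiplicity of `σ` …; we have `n_σ + n_σ′ =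
2g/[F:ℚ]` for all `σ ∈ Σ_F`»; the second Remark after the Criterion: «If all simple factors of `X` are of type 1, 2 or 3 in
the Albert classification, then every subfield `F ⊆ End⁰(X)` satisfies the condition that `n_σ = n_σ′` for all `σ ∈ Σ_F`»;
Criterion (2) (chunk p0003): «Suppose `F ↪ End⁰(X)` is a subfield such that `W_F = ⋀^r V_X` consists of Hodge classes (see
section (crit1), and recall that this assumption implies that `r = dim_F(V_X)` is even).  Then either all classes in `W_F`
are decomposable, or all non-zero classes in `W_F` are exceptional»; §2 Example (chunk p0002): «Let `X = Y₁ × Y₂` where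
the ratios `2dim(Y₁)/[F:ℚ]` and `2dim(Y₂)/[F:ℚ]` are odd.  Then non-zero elements of `W_F(Y₁)` and `W_F(Y₂)` are not Hodge
classes».

RENDERING.  `A` a complex abelian variety, `F = ℚ(φ)` for `φ ∈ End(A)` with `P(φ) = 0`, `P ∈ ℤ[T]` monic and irreducible
over `ℚ` of degree `e = [F:ℚ]`; `r` with `e · r = 2 dim A`; `n_ρ = eigenMultiplicity A φ ρ = dim (V_ρ ∩ H^{1,0})` at a
complex root `ρ` of `P` (`V_ρ = ker(φ^* − ρ) ⊆ H¹(A(ℂ); ℂ)`); `W_F ⊗ ℂ = weilClassesField A φ P r`; «no simple factor of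
type IV» = the tree's `HasNoTypeIVFactor A` (the centre of `End⁰(A)` is elementwise totally real); «decomposable» =
`∈ divisorClassesSpan A.X A.dim m = Dᵐ ⊗ ℂ`; `G_div(X)(ℂ)` = Milne's `unitaryCentralizerGroup A h` for a class
`h ∈ B¹(A) ⊗ ℂ` with non-degenerate `Q_h`.

WHAT IS PROVED.
* §1 (any `A`) `natDegree_dvd_two_mul_dim` — «`r = 2g/[F:ℚ]`» is an integer: `e ∣ 2 dim A`;
  **`even_of_forall_eigenMultiplicity_eq`** — «recall that this assumption implies that `r` is even»: balanced
  multiplicities (`n_ρ = n_ρ̄` at every root — Criterion (1): `W_F` Hodge) force `r` even, since `n_ρ + n_ρ̄ = r`;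
  `even_of_forall_isOfHodgeType_weilClassesField`, `even_of_isRationalClass_isOfHodgeType_ne_zero` — the same from «`W_F`
  consists of Hodge classes» / from ONE non-zero rational Hodge class in `W_F` (all or nothing); and the §2 Example's
  mechanism `forall_eq_zero_of_odd` — for `r` odd the only rational Hodge class of `W_F ⊗ ℂ` is `0`.
* §2 (no factor of type IV) **`two_mul_eigenMultiplicity_eq_finrank_eigenspace_of_hasNoTypeIVFactor`** — `2 n_ρ = dim V_ρ`;
  **`eigenMultiplicity_mul_natDegree_eq_dim_of_hasNoTypeIVFactor`** — every root has the same multiplicity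
  `n_ρ = dim A / [F:ℚ]`; **`natDegree_dvd_dim_of_hasNoTypeIVFactor`** — `[F:ℚ] ∣ dim A` for every such `F = ℚ(φ)`;
  `even_of_hasNoTypeIVFactor` — `r` is even; contrapositives `not_hasNoTypeIVFactor_of_odd` (the factors `Yᵢ` of the
  §2 Example have a simple factor of type IV) and `not_hasNoTypeIVFactor_of_natDegree_eq_two_mul_dim` (multiplication by a
  field of degree `2 dim A` forces a factor of type IV).
* §3 (no factor of type IV, `e · 2m = 2 dim A`, `m ≠ 0`) `exists_isRationalClass_isOfHodgeType_ne_zero_of_hasNoTypeIVFactor`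
  — `W_F` contains a non-zero rational Hodge class; **`weilClassesField_dichotomy_of_hasNoTypeIVFactor`** — Criterion (2)'s
  first sentence with its hypothesis discharged: all of `W_F ⊗ ℂ` is of type `(m, m)` and EITHER `W_F ⊗ ℂ ≤ Dᵐ ⊗ ℂ` OR
  every non-zero rational class of `W_F ⊗ ℂ` is exceptional; `not_forall_eq_zero_of_hasNoTypeIVFactor` — the alternative
  «`0` is the only Hodge class in `W_F`» of the trichotomy does not occur;
  **`exists_exceptional_iff_exists_detOnEigenspace_ne_one_of_hasNoTypeIVFactor`** — «this last possibility occurs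
  precisely» when some `u ∈ G_div(X)(ℂ)` has `det(u | V_ρ) ≠ 1` at some root: `W_F` contains an exceptional rational Hodge
  class iff `∃ u ∈ S(A)(h)(ℂ), ρ, det(u | V_ρ) ≠ 1`; `forall_mem_divisorClassesSpan_iff_forall_detOnEigenspace_eq_one_of_
  hasNoTypeIVFactor` — and all of `W_F` is decomposable iff `det(u | V_ρ) = 1` throughout (the seat's unconditional
  criterion, recalled in the dichotomy's language).

Honesty clause: the type-by-type case list of Criterion (2) (types III and IV) is not touched; nothing here proves a Weil
class algebraic; «no factor of type IV» is the tree's elementwise predicate on the centre of `End⁰(A)`.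
No `sorry`; axioms `propext`, `Classical.choice`, `Quot.sound`.

## References
* [MoonenZarhin1998WeilClasses] B. J. J. Moonen, Yu. G. Zarhin, *Weil classes on abelian varieties*, J. reine angew.
  Math. 496 (1998) 83–92 = arXiv:alg-geom/9612017, §1 (chunk p0001: `r = 2g/[F:ℚ]`, `n_σ + n_σ′ = 2g/[F:ℚ]`, the section
  «all or nothing», Criterion (1) and the second Remark after it), Criterion (2) (chunk p0003, first sentence: «recall that
  this assumption implies that `r = dim_F(V_X)` is even»), §2 Example (chunk p0002).
* [Milne1999LefschetzClasses] J. S. Milne, *Lefschetz classes on abelian varieties*, Duke Math. J. 96 (1999) 639–675,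
  Thm. 3.2, Thm. 4.4, Cor. 4.5.
* [LangeBirkenhake1992] H. Lange, Ch. Birkenhake, *Complex Abelian Varieties*, §5.5 (Albert types; Prop. 5.5.7, the
  divisibility restrictions on `End⁰`).
-/

noncomputable section

open CategoryTheory Polynomial Module

namespace Literature.AlgebraicGeometry.HodgeTheory

open Literature.AlgebraicTopology.SingularHomology
open Literature.AlgebraicGeometry.Motives
open Literature.AlgebraicGeometry.VanGeemen1994 (hodgeClassSpan pullbackOne detOnEigenspace)
open Literature.AlgebraicGeometry.Milne1999 (unitaryCentralizerGroup)
open Literature.Barriers.HodgeConjecture (divisorClassesSpan)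

section HodgeTheory

variable {A : AbelianVariety ℂ} {φ : A ⟶ A} {P : Polynomial ℤ} {e r m : ℕ} {h : complexBetti A.X 2}

/-! ### §0 A complex root of `P` -/

/-- A polynomial `P ∈ ℤ[T]` irreducible over `ℚ` has a complex root. [folklore] -/
private theorem exists_eval₂_eq_zero (hPirr : Irreducible (P.map (Int.castRingHom ℚ))) :
    ∃ ρ : ℂ, Polynomial.eval₂ (Int.castRingHom ℂ) ρ P = 0 := by
  have hdeg : 0 < degree (P.map (Int.castRingHom ℂ)) := by
    rw [← natDegree_pos_iff_degree_pos, natDegree_map_eq_of_injective (RingHom.injective_int (Int.castRingHom ℂ)) P,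
      ← natDegree_map_eq_of_injective (RingHom.injective_int (Int.castRingHom ℚ)) P]
    exact natDegree_pos_iff_degree_pos.2 (degree_pos_of_irreducible hPirr)
  obtain ⟨ρ, hρ⟩ := Complex.exists_root hdeg
  exact ⟨ρ, by rwa [IsRoot.def, Polynomial.eval_map] at hρ⟩

/-! ### §1 «`r = 2g/[F:ℚ]`», and `r` is even as soon as `W_F` is Hodge -/

section Parity

/-- **«`r = 2g/[F:ℚ]`» IS AN INTEGER**: for `φ ∈ End(A)` with `P(φ) = 0`, `P ∈ ℤ[T]` monic and irreducible over `ℚ`, the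
degree `[ℚ(φ):ℚ] = deg P` divides `2 dim A` (`dim V_ρ · deg P = 2 dim A` at any complex root `ρ`, the tree's
`finrank_eigenspace_mul_natDegree_eq`). [cite: MoonenZarhin1998WeilClasses, §1 Introduction («let r = 2g/[F:ℚ]»; chunk p0001)]
[cite: LangeBirkenhake1992, §5.5 Prop. 5.5.7] -/
theorem natDegree_dvd_two_mul_dim (hPm : P.Monic) (hPirr : Irreducible (P.map (Int.castRingHom ℚ)))
    (hφ : Polynomial.eval₂ (Int.castRingHom (CategoryTheory.End A)) (φ : CategoryTheory.End A) P = 0) :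
    P.natDegree ∣ 2 * A.dim := by
  obtain ⟨ρ, hρ⟩ := exists_eval₂_eq_zero hPirr
  exact Dvd.intro_left _ (finrank_eigenspace_mul_natDegree_eq hPm hPirr hφ hρ)

/-- **«RECALL THAT THIS ASSUMPTION IMPLIES THAT `r = dim_F(V_X)` IS EVEN»** (Criterion (2), first sentence; the assumption
being Criterion (1)'s `n_σ = n_σ′` for all `σ`): if `n_ρ = n_ρ̄` at every complex root `ρ` of `P` then `r` is even — indeed
`n_ρ + n_ρ̄ = r` (the tree's `eigenMultiplicity_add_eigenMultiplicity_conj_eq`), so `r = 2 n_ρ`.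
[cite: MoonenZarhin1998WeilClasses, §1 Criterion (2), first sentence (chunk p0003) and §1 «n_σ + n_σ′ = 2g/[F:ℚ]» (chunk p0001)] -/
theorem even_of_forall_eigenMultiplicity_eq (hPm : P.Monic) (hPe : P.natDegree = e)
    (hPirr : Irreducible (P.map (Int.castRingHom ℚ)))
    (hφ : Polynomial.eval₂ (Int.castRingHom (CategoryTheory.End A)) (φ : CategoryTheory.End A) P = 0)
    (her : e * r = 2 * A.dim)
    (hbal : ∀ ρ : ℂ, Polynomial.eval₂ (Int.castRingHom ℂ) ρ P = 0 →
      eigenMultiplicity A φ ρ = eigenMultiplicity A φ (starRingEnd ℂ ρ)) :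
    Even r := by
  obtain ⟨ρ, hρ⟩ := exists_eval₂_eq_zero hPirr
  have hsum := eigenMultiplicity_add_eigenMultiplicity_conj_eq hPm hPe hPirr hφ her hρ
  rw [hbal ρ hρ] at hsum
  exact ⟨_, hsum.symm⟩

/-- **… hence `[F:ℚ] ∣ dim A` when the multiplicities are balanced** (`e · r = 2 dim A` with `r` even).
[cite: MoonenZarhin1998WeilClasses, §1 Criterion (2), first sentence (chunk p0003)] -/
theorem natDegree_dvd_dim_of_forall_eigenMultiplicity_eq (hPm : P.Monic) (hPe : P.natDegree = e)
    (hPirr : Irreducible (P.map (Int.castRingHom ℚ)))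
    (hφ : Polynomial.eval₂ (Int.castRingHom (CategoryTheory.End A)) (φ : CategoryTheory.End A) P = 0)
    (her : e * r = 2 * A.dim)
    (hbal : ∀ ρ : ℂ, Polynomial.eval₂ (Int.castRingHom ℂ) ρ P = 0 →
      eigenMultiplicity A φ ρ = eigenMultiplicity A φ (starRingEnd ℂ ρ)) :
    e ∣ A.dim := by
  obtain ⟨k, hk⟩ := even_of_forall_eigenMultiplicity_eq hPm hPe hPirr hφ her hbal
  refine ⟨k, Nat.eq_of_mul_eq_mul_left two_pos ?_⟩
  rw [← her, hk]
  ring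

/-- **«`W_F` consists of Hodge classes» ⟹ `r` is even**, with «Hodge» read class by class on `W_F ⊗ ℂ ⊆ Hʳ(A(ℂ); ℂ)`
(type `(r/2, r/2)`; the tree's `forall_isOfHodgeType_weilClassesField_iff_balanced` = Criterion (1)).
[cite: MoonenZarhin1998WeilClasses, §1 Criterion (1) (chunk p0001) and Criterion (2), first sentence (chunk p0003)] -/
theorem even_of_forall_isOfHodgeType_weilClassesField (hPm : P.Monic) (hPe : P.natDegree = e)
    (hPirr : Irreducible (P.map (Int.castRingHom ℚ)))
    (hφ : Polynomial.eval₂ (Int.castRingHom (CategoryTheory.End A)) (φ : CategoryTheory.End A) P = 0)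
    (her : e * r = 2 * A.dim) (hH : ∀ c ∈ weilClassesField A φ P r, IsOfHodgeType A.dim A.X r (r / 2) (r / 2) c) :
    Even r :=
  even_of_forall_eigenMultiplicity_eq hPm hPe hPirr hφ her
    ((forall_isOfHodgeType_weilClassesField_iff_balanced hPm hPe hPirr hφ her).1 hH)

/-- **ONE non-zero rational Hodge class in `W_F` ⟹ `r` is even** (all or nothing: one such class makes all of `W_F ⊗ ℂ`
Hodge, the tree's `exists_isRationalClass_isOfHodgeType_ne_zero_iff_balanced`).
[cite: MoonenZarhin1998WeilClasses, §1 section «all or nothing» and Criterion (1) (chunk p0001); Criterion (2), first sentence] -/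
theorem even_of_isRationalClass_isOfHodgeType_ne_zero (hPm : P.Monic) (hPe : P.natDegree = e)
    (hPirr : Irreducible (P.map (Int.castRingHom ℚ)))
    (hφ : Polynomial.eval₂ (Int.castRingHom (CategoryTheory.End A)) (φ : CategoryTheory.End A) P = 0)
    (her : e * r = 2 * A.dim) {γ : complexBetti A.X r} (hγW : γ ∈ weilClassesField A φ P r)
    (hγQ : IsRationalClass γ) (hγH : IsOfHodgeType A.dim A.X r (r / 2) (r / 2) γ) (hγ0 : γ ≠ 0) :
    Even r := by
  rcases Nat.eq_zero_or_pos r with hr | hr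
  · exact hr ▸ Even.zero
  · exact even_of_forall_eigenMultiplicity_eq hPm hPe hPirr hφ her
      ((exists_isRationalClass_isOfHodgeType_ne_zero_iff_balanced hPm hPe hPirr hφ her hr.ne').1
        ⟨γ, hγW, hγQ, hγH, hγ0⟩)

/-- **THE §2 EXAMPLE'S MECHANISM — «the ratios `2dim(Yᵢ)/[F:ℚ]` are odd. Then non-zero elements of `W_F(Yᵢ)` are not
Hodge classes»**: for `r` odd, the only rational class of `W_F ⊗ ℂ` of Hodge type `(r/2, r/2)` is `0`.
[cite: MoonenZarhin1998WeilClasses, §2 Example (chunk p0002, lines 33–38)] -/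
theorem forall_eq_zero_of_odd (hPm : P.Monic) (hPe : P.natDegree = e) (hPirr : Irreducible (P.map (Int.castRingHom ℚ)))
    (hφ : Polynomial.eval₂ (Int.castRingHom (CategoryTheory.End A)) (φ : CategoryTheory.End A) P = 0)
    (her : e * r = 2 * A.dim) (hr : Odd r) :
    ∀ γ ∈ weilClassesField A φ P r, IsRationalClass γ → IsOfHodgeType A.dim A.X r (r / 2) (r / 2) γ → γ = 0 := by
  intro γ hγW hγQ hγH
  by_contra hγ0
  exact Nat.not_even_iff_odd.2 hr (even_of_isRationalClass_isOfHodgeType_ne_zero hPm hPe hPirr hφ her hγW hγQ hγH hγ0)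

end Parity

/-! ### §2 No simple factor of type IV: `n_ρ = dim A/[F:ℚ]` at every root, `[F:ℚ] ∣ dim A`, `r` even -/

section NoTypeIV

/-- **WITH NO FACTOR OF TYPE IV, `2 n_ρ = dim V_ρ` AT EVERY COMPLEX ROOT** (the second Remark: `n_ρ = n_ρ̄`, the seat's
`eigenMultiplicity_eq_of_hasNoTypeIVFactor`; and `dim V_ρ = n_ρ + n_ρ̄` by the Hodge decomposition of `H¹` and complex
conjugation, the tree's `finrank_eigenspace_eq_add` / `finrank_eigenspace_inf_hodgeZeroOne_eq`).
[cite: MoonenZarhin1998WeilClasses, §1 second Remark after the Criterion and «n_σ + n_σ′ = 2g/[F:ℚ]» (chunks p0001–p0002)] -/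
theorem two_mul_eigenMultiplicity_eq_finrank_eigenspace_of_hasNoTypeIVFactor (hA4 : HasNoTypeIVFactor A)
    (hPirr : Irreducible (P.map (Int.castRingHom ℚ)))
    (hφ : Polynomial.eval₂ (Int.castRingHom (CategoryTheory.End A)) (φ : CategoryTheory.End A) P = 0) (ρ : ℂ) :
    2 * eigenMultiplicity A φ ρ = Module.finrank ℂ ↥(Module.End.eigenspace (complexBetti.map φ.hom.hom.hom 1).hom ρ) := by
  haveI := finite_complexBetti_abelianVariety A 1
  have hX : IsSmoothProjective A.dim A.X := Motives.AbelianVariety.isSmoothProjective_holds (A := A)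
  have hconj := eigenMultiplicity_eq_of_hasNoTypeIVFactor hA4 hPirr hφ ρ
  rw [finrank_eigenspace_eq_add hX φ.hom.hom.hom ρ, two_mul]
  congr 1
  rw [hconj, eigenMultiplicity, ← finrank_eigenspace_inf_hodgeZeroOne_eq hX φ.hom.hom.hom (starRingEnd ℂ ρ),
    Complex.conj_conj]

/-- **WITH NO FACTOR OF TYPE IV EVERY EMBEDDING OF `F = ℚ(φ)` HAS THE SAME MULTIPLICITY `n_ρ = dim A / [F:ℚ]` ON THE
TANGENT SPACE**: `n_ρ · deg P = dim A` at every complex root `ρ` of `P` (`2 n_ρ = dim V_ρ` and `dim V_ρ · deg P = 2 dim A`).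
[cite: MoonenZarhin1998WeilClasses, §1 second Remark after the Criterion (chunk p0002) with «n_σ + n_σ′ = 2g/[F:ℚ]» (chunk p0001)] -/
theorem eigenMultiplicity_mul_natDegree_eq_dim_of_hasNoTypeIVFactor (hA4 : HasNoTypeIVFactor A) (hPm : P.Monic)
    (hPirr : Irreducible (P.map (Int.castRingHom ℚ)))
    (hφ : Polynomial.eval₂ (Int.castRingHom (CategoryTheory.End A)) (φ : CategoryTheory.End A) P = 0) {ρ : ℂ}
    (hρ : Polynomial.eval₂ (Int.castRingHom ℂ) ρ P = 0) :
    eigenMultiplicity A φ ρ * P.natDegree = A.dim := by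
  have h := finrank_eigenspace_mul_natDegree_eq hPm hPirr hφ hρ
  rw [← two_mul_eigenMultiplicity_eq_finrank_eigenspace_of_hasNoTypeIVFactor hA4 hPirr hφ ρ, mul_assoc] at h
  exact Nat.eq_of_mul_eq_mul_left two_pos h

/-- **WITH NO FACTOR OF TYPE IV, `[F:ℚ] ∣ dim A` FOR EVERY SUBFIELD `F = ℚ(φ) ⊆ End⁰(A)`** (`φ ∈ End(A)` with `P(φ) = 0`,
`P ∈ ℤ[T]` monic irreducible over `ℚ`): `deg P ∣ dim A` — i.e. «`r = 2g/[F:ℚ]` is even» (next theorem).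
[cite: MoonenZarhin1998WeilClasses, §1 second Remark after the Criterion (chunk p0002) and Criterion (2), first sentence (chunk p0003)]
[cite: LangeBirkenhake1992, §5.5 Prop. 5.5.7] -/
theorem natDegree_dvd_dim_of_hasNoTypeIVFactor (hA4 : HasNoTypeIVFactor A) (hPm : P.Monic)
    (hPirr : Irreducible (P.map (Int.castRingHom ℚ)))
    (hφ : Polynomial.eval₂ (Int.castRingHom (CategoryTheory.End A)) (φ : CategoryTheory.End A) P = 0) :
    P.natDegree ∣ A.dim := by
  obtain ⟨ρ, hρ⟩ := exists_eval₂_eq_zero hPirr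
  exact Dvd.intro_left _ (eigenMultiplicity_mul_natDegree_eq_dim_of_hasNoTypeIVFactor hA4 hPm hPirr hφ hρ)

/-- **WITH NO FACTOR OF TYPE IV, `r = dim_F(V_X)` IS EVEN FOR EVERY `F`** (the second Remark gives `n_σ = n_σ′` for every
subfield, and then «recall that this assumption implies that `r` is even»).
[cite: MoonenZarhin1998WeilClasses, §1 second Remark after the Criterion (chunk p0002) and Criterion (2), first sentence (chunk p0003)] -/
theorem even_of_hasNoTypeIVFactor (hA4 : HasNoTypeIVFactor A) (hPm : P.Monic) (hPe : P.natDegree = e)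
    (hPirr : Irreducible (P.map (Int.castRingHom ℚ)))
    (hφ : Polynomial.eval₂ (Int.castRingHom (CategoryTheory.End A)) (φ : CategoryTheory.End A) P = 0)
    (her : e * r = 2 * A.dim) : Even r :=
  even_of_forall_eigenMultiplicity_eq hPm hPe hPirr hφ her fun ρ _ => eigenMultiplicity_eq_of_hasNoTypeIVFactor hA4 hPirr hφ ρ

/-- **CONTRAPOSITIVE — THE FACTORS OF THE §2 EXAMPLE HAVE A SIMPLE FACTOR OF TYPE IV**: if `End(A) ∋ φ` with `P(φ) = 0`,
`P` monic irreducible of degree `e`, and `e · r = 2 dim A` with `r` ODD («the ratios `2dim(Yᵢ)/[F:ℚ]` are odd»), then `A`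
does not satisfy `HasNoTypeIVFactor`. [cite: MoonenZarhin1998WeilClasses, §2 Example (chunk p0002) with §1 second Remark] -/
theorem not_hasNoTypeIVFactor_of_odd (hPm : P.Monic) (hPe : P.natDegree = e) (hPirr : Irreducible (P.map (Int.castRingHom ℚ)))
    (hφ : Polynomial.eval₂ (Int.castRingHom (CategoryTheory.End A)) (φ : CategoryTheory.End A) P = 0)
    (her : e * r = 2 * A.dim) (hr : Odd r) : ¬ HasNoTypeIVFactor A :=
  fun hA4 => Nat.not_even_iff_odd.2 hr (even_of_hasNoTypeIVFactor hA4 hPm hPe hPirr hφ her)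

/-- **IN PARTICULAR (`r = 1`): MULTIPLICATION BY A FIELD OF DEGREE `2 dim A` FORCES A FACTOR OF TYPE IV** — if `End(A) ∋ φ`
with `P(φ) = 0`, `P` monic irreducible over `ℚ` of degree `2 dim A` (so `A` is of CM type through `F = ℚ(φ)`), then
`¬ HasNoTypeIVFactor A`. [cite: MoonenZarhin1998WeilClasses, §1 second Remark after the Criterion and Criterion (2), first sentence]
[cite: LangeBirkenhake1992, §5.5 Prop. 5.5.7] -/
theorem not_hasNoTypeIVFactor_of_natDegree_eq_two_mul_dim (hPm : P.Monic) (hPe : P.natDegree = 2 * A.dim)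
    (hPirr : Irreducible (P.map (Int.castRingHom ℚ)))
    (hφ : Polynomial.eval₂ (Int.castRingHom (CategoryTheory.End A)) (φ : CategoryTheory.End A) P = 0) :
    ¬ HasNoTypeIVFactor A :=
  not_hasNoTypeIVFactor_of_odd (r := 1) hPm hPe hPirr hφ (Nat.mul_one _) odd_one

/-- **`[F:ℚ] ∤ dim A` FORCES A FACTOR OF TYPE IV** (contrapositive of `natDegree_dvd_dim_of_hasNoTypeIVFactor`).
[cite: MoonenZarhin1998WeilClasses, §1 second Remark after the Criterion and Criterion (2), first sentence] -/
theorem not_hasNoTypeIVFactor_of_not_natDegree_dvd_dim (hPm : P.Monic) (hPirr : Irreducible (P.map (Int.castRingHom ℚ)))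
    (hφ : Polynomial.eval₂ (Int.castRingHom (CategoryTheory.End A)) (φ : CategoryTheory.End A) P = 0)
    (hnd : ¬ P.natDegree ∣ A.dim) : ¬ HasNoTypeIVFactor A :=
  fun hA4 => hnd (natDegree_dvd_dim_of_hasNoTypeIVFactor hA4 hPm hPirr hφ)

end NoTypeIV

/-! ### §3 No simple factor of type IV: the trichotomy is Criterion (2)'s dichotomy -/

section Dichotomy

/-- **WITH NO FACTOR OF TYPE IV, `W_F` CONTAINS A NON-ZERO RATIONAL HODGE CLASS** (`e · r = 2 dim A`, `r ≠ 0`): the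
multiplicities are balanced (second Remark), so the all-or-nothing lemma produces a non-zero rational class of `W_F ⊗ ℂ`
of type `(r/2, r/2)`. [cite: MoonenZarhin1998WeilClasses, §1 second Remark after the Criterion, Criterion (1) and the
section «all or nothing» (chunks p0001–p0002)] -/
theorem exists_isRationalClass_isOfHodgeType_ne_zero_of_hasNoTypeIVFactor (hA4 : HasNoTypeIVFactor A) (hPm : P.Monic)
    (hPe : P.natDegree = e) (hPirr : Irreducible (P.map (Int.castRingHom ℚ)))
    (hφ : Polynomial.eval₂ (Int.castRingHom (CategoryTheory.End A)) (φ : CategoryTheory.End A) P = 0)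
    (her : e * r = 2 * A.dim) (hr : r ≠ 0) :
    ∃ γ ∈ weilClassesField A φ P r, IsRationalClass γ ∧ IsOfHodgeType A.dim A.X r (r / 2) (r / 2) γ ∧ γ ≠ 0 :=
  (exists_isRationalClass_isOfHodgeType_ne_zero_iff_balanced hPm hPe hPirr hφ her hr).2
    fun ρ _ => eigenMultiplicity_eq_of_hasNoTypeIVFactor hA4 hPirr hφ ρ

/-- **CRITERION (2), FIRST SENTENCE, WITH ITS HYPOTHESIS DISCHARGED FOR TYPES I–III: «either all classes in `W_F` are
decomposable, or all non-zero classes in `W_F` are exceptional»** — for `A` with no factor of type IV, `P` monic irreducible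
of degree `e`, `P(φ) = 0`, `e · 2m = 2 dim A`, `m ≠ 0`: every class of `W_F ⊗ ℂ` is of Hodge type `(m, m)` (second Remark +
Criterion (1)), and either `W_F ⊗ ℂ ≤ Dᵐ ⊗ ℂ` or every non-zero RATIONAL class of `W_F ⊗ ℂ` lies outside `Dᵐ ⊗ ℂ` (the
printed trichotomy, the tree's `weilClassesField_trichotomy`, loses its first alternative).
[cite: MoonenZarhin1998WeilClasses, §1 Criterion (2), first sentence (chunk p0003); second Remark after the Criterion
(chunk p0002); section «all or nothing» (chunk p0001)] [cite: vanGeemen1994HodgeAV, §2.4] -/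
theorem weilClassesField_dichotomy_of_hasNoTypeIVFactor (hA4 : HasNoTypeIVFactor A) (hPm : P.Monic)
    (hPe : P.natDegree = e) (hPirr : Irreducible (P.map (Int.castRingHom ℚ)))
    (hφ : Polynomial.eval₂ (Int.castRingHom (CategoryTheory.End A)) (φ : CategoryTheory.End A) P = 0)
    (her : e * (2 * m) = 2 * A.dim) (hm : m ≠ 0) :
    (∀ c ∈ weilClassesField A φ P (2 * m), IsOfHodgeType A.dim A.X (2 * m) m m c) ∧
      (weilClassesField A φ P (2 * m) ≤ divisorClassesSpan A.X A.dim m ∨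
        ∀ c ∈ weilClassesField A φ P (2 * m), IsRationalClass c → c ≠ 0 → c ∉ divisorClassesSpan A.X A.dim m) := by
  refine ⟨fun c hc => ?_, weilClassesField_le_divisorClassesSpan_or_forall_not_mem hPe hPirr hφ her hm⟩
  have h := forall_isOfHodgeType_of_mem_weilClassesField_of_hasNoTypeIVFactor hA4 hPm hPe hPirr hφ her c hc
  rwa [Nat.mul_div_cancel_left m two_pos] at h

/-- **… so the alternative «`0 ∈ W_F` is the only Hodge class» of the trichotomy does not occur for types I–III**
(`e · 2m = 2 dim A`, `m ≠ 0`). [cite: MoonenZarhin1998WeilClasses, §1 section «all or nothing» (chunk p0001) and second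
Remark after the Criterion (chunk p0002)] -/
theorem not_forall_eq_zero_of_hasNoTypeIVFactor (hA4 : HasNoTypeIVFactor A) (hPm : P.Monic) (hPe : P.natDegree = e)
    (hPirr : Irreducible (P.map (Int.castRingHom ℚ)))
    (hφ : Polynomial.eval₂ (Int.castRingHom (CategoryTheory.End A)) (φ : CategoryTheory.End A) P = 0)
    (her : e * (2 * m) = 2 * A.dim) (hm : m ≠ 0) :
    ¬ ∀ c ∈ weilClassesField A φ P (2 * m), IsRationalClass c → IsOfHodgeType A.dim A.X (2 * m) m m c → c = 0 := by
  obtain ⟨γ, hγW, hγQ, hγH, hγ0⟩ :=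
    exists_isRationalClass_isOfHodgeType_ne_zero_of_hasNoTypeIVFactor hA4 hPm hPe hPirr hφ her (by omega)
  rw [Nat.mul_div_cancel_left m two_pos] at hγH
  exact fun h0 => hγ0 (h0 γ hγW hγQ hγH)

/-- **«THIS LAST POSSIBILITY OCCURS PRECISELY» WHEN `G_div(X)(ℂ) ⊄ Sl_F`, FOR TYPES I–III** (`e · 2m = 2 dim A`, `m ≠ 0`,
`h ∈ B¹(A) ⊗ ℂ` with `Q_h` non-degenerate): `W_F` contains an EXCEPTIONAL rational Hodge class (a rational class of type
`(m, m)` outside `Dᵐ ⊗ ℂ` — then all its non-zero rational classes are such) iff some `u ∈ S(A)(h)(ℂ)` has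
`det(u | V_ρ) ≠ 1` at some complex root `ρ` of `P` (the seat's unconditional `weilClassesField_inf_divisorClassesSpan_eq_
bot_iff_exists_detOnEigenspace_ne_one`, with the Hodge condition supplied by the second Remark).
[cite: MoonenZarhin1998WeilClasses, §1 Criterion (2) and its proof (chunk p0003); second Remark after the Criterion]
[cite: Milne1999LefschetzClasses, Thm. 3.2, Thm. 4.4, Cor. 4.5] -/
theorem exists_exceptional_iff_exists_detOnEigenspace_ne_one_of_hasNoTypeIVFactor (hA4 : HasNoTypeIVFactor A)
    (hPm : P.Monic) (hPe : P.natDegree = e) (hPirr : Irreducible (P.map (Int.castRingHom ℚ)))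
    (hφ : Polynomial.eval₂ (Int.castRingHom (CategoryTheory.End A)) (φ : CategoryTheory.End A) P = 0)
    (her : e * (2 * m) = 2 * A.dim) (hm : m ≠ 0) (hh : h ∈ hodgeClassSpan A.dim A.X 1)
    (hnd : ∀ x : complexBetti A.X 1, (∀ y, polarizationPairingOne A.X h (A.dim - 1) x y = 0) → x = 0) :
    (∃ γ ∈ weilClassesField A φ P (2 * m), IsRationalClass γ ∧ IsOfHodgeType A.dim A.X (2 * m) m m γ ∧
        γ ∉ divisorClassesSpan A.X A.dim m) ↔
      ∃ (u : complexBetti A.X 1 ≃ₗ[ℂ] complexBetti A.X 1) (hu : u ∈ unitaryCentralizerGroup A h) (ρ : ℂ),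
        Polynomial.eval₂ (Int.castRingHom ℂ) ρ P = 0 ∧ detOnEigenspace u (pullbackOne A φ) (hu.1 φ) ρ ≠ 1 := by
  rw [← weilClassesField_inf_divisorClassesSpan_eq_bot_iff_exists_detOnEigenspace_ne_one hPm hPe hPirr hφ her hm hh hnd]
  refine ⟨fun ⟨γ, hγW, _, _, hγD⟩ => ?_, fun hbot => ?_⟩
  · rcases weilClassesField_inf_divisorClassesSpan_eq_bot_or_le hPe hPirr hφ her hm with hbot | hle
    · exact hbot
    · exact absurd (hle hγW) hγD
  · obtain ⟨γ, hγW, hγQ, hγH, hγ0⟩ :=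
      exists_isRationalClass_isOfHodgeType_ne_zero_of_hasNoTypeIVFactor hA4 hPm hPe hPirr hφ her (by omega)
    rw [Nat.mul_div_cancel_left m two_pos] at hγH
    refine ⟨γ, hγW, hγQ, hγH, fun hγD => hγ0 ?_⟩
    have hγ : γ ∈ weilClassesField A φ P (2 * m) ⊓ divisorClassesSpan A.X A.dim m := ⟨hγW, hγD⟩
    rwa [hbot, Submodule.mem_bot] at hγ

/-- **… AND «ALL CLASSES IN `W_F` ARE DECOMPOSABLE» IFF `G_div(X)(ℂ) ⊂ Sl_F`, FOR TYPES I–III, in the dichotomy's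
language**: every rational Hodge class of `W_F` is decomposable iff `det(u | V_ρ) = 1` for all `u ∈ S(A)(h)(ℂ)` and all
roots (the seat's unconditional `weilClassesField_le_divisorClassesSpan_iff_forall_detOnEigenspace_eq_one`; under no type IV
every class of `W_F ⊗ ℂ` is Hodge, so «every rational Hodge class decomposable» is «`W_F ⊗ ℂ ≤ Dᵐ ⊗ ℂ`» by all or nothing).
[cite: MoonenZarhin1998WeilClasses, §1 Criterion (2) and its proof (chunk p0003); second Remark after the Criterion]
[cite: Milne1999LefschetzClasses, Thm. 3.2, Thm. 4.4, Cor. 4.5] -/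
theorem forall_mem_divisorClassesSpan_iff_forall_detOnEigenspace_eq_one_of_hasNoTypeIVFactor (hA4 : HasNoTypeIVFactor A)
    (hPm : P.Monic) (hPe : P.natDegree = e) (hPirr : Irreducible (P.map (Int.castRingHom ℚ)))
    (hφ : Polynomial.eval₂ (Int.castRingHom (CategoryTheory.End A)) (φ : CategoryTheory.End A) P = 0)
    (her : e * (2 * m) = 2 * A.dim) (hm : m ≠ 0) (hh : h ∈ hodgeClassSpan A.dim A.X 1)
    (hnd : ∀ x : complexBetti A.X 1, (∀ y, polarizationPairingOne A.X h (A.dim - 1) x y = 0) → x = 0) :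
    (∀ γ ∈ weilClassesField A φ P (2 * m), IsRationalClass γ → IsOfHodgeType A.dim A.X (2 * m) m m γ →
        γ ∈ divisorClassesSpan A.X A.dim m) ↔
      ∀ u (hu : u ∈ unitaryCentralizerGroup A h) (ρ : ℂ), Polynomial.eval₂ (Int.castRingHom ℂ) ρ P = 0 →
        detOnEigenspace u (pullbackOne A φ) (hu.1 φ) ρ = 1 := by
  rw [← weilClassesField_le_divisorClassesSpan_iff_forall_detOnEigenspace_eq_one hPm hPe hPirr hφ her hh hnd]
  refine ⟨fun hall => ?_, fun hle γ hγW _ _ => hle hγW⟩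
  obtain ⟨γ, hγW, hγQ, hγH, hγ0⟩ :=
    exists_isRationalClass_isOfHodgeType_ne_zero_of_hasNoTypeIVFactor hA4 hPm hPe hPirr hφ her (by omega)
  rw [Nat.mul_div_cancel_left m two_pos] at hγH
  exact weilClassesField_le_divisorClassesSpan_of_isRationalClass_of_ne_zero hPe hPirr hφ her hm hγW hγQ hγ0
    (hall γ hγW hγQ hγH)

end Dichotomy

end HodgeTheory

end Literature.AlgebraicGeometry.HodgeTheory

end
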